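/-
Copyright (c) 2026 the pub-hodgecm-mathlib formalisation cell (harness21).  Prover seat hodgecm-mathlib-R90-C131-p02 (g2) on the S4 valve (dealer K2E2-plan (g8), S4-R59 (4) ∕
S4-R63), road (J̃♭) FILE (TJ6) «HERBRAND WINDOW», part 2b of 3: `ψ(W) = W(1 + W²)⁻¹` IS ONTO EACH EIGEN-LATTICE (filtered Newton, Cantor-intersection form).
Crux H413 `stmt-HodgeConjecture-24833`, lane `--supports … --as helper` (count-neutral).  THEOREMS ONLY (no `def`, no `instance`, no notation, no named-fact hypothesis, no `sorry`).
-/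
import Summits.HodgeConjecture.HodgeConjecture.Theorems.R90S4CayleyVelocityLaw         -- (TJ6) part 2a (this seat): `map_nonsing_inv_eq`, `map_one_add_mul_eq` (brings ★ (C2), ★ `nonsing_inv_comm_of_comm`)
import Summits.HodgeConjecture.HodgeConjecture.Theorems.F0P3cStCharTSCayleyChartHaar    -- ★ (C4): `level_antitone`, `isOpen_level`, `isCompact_level`, `exists_level_subset_of_mem_nhds`, `isCompact_setOf_valBound_matrix` (brings ★ (C1a) FilteredNewton)
import Literature.NumberTheory.GaloisRepresentations.LocalField                          -- ★ `IsNonarchimedeanLocalField.isLocalField` (Hausdorff)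
import HarnessLib

/-!
# R90-TF · S4 (Ch. 13.1–2) · road (J̃♭) «TWISTED TUBE JACOBIAN», FILE (TJ6) «HERBRAND WINDOW», part 2b: `ψ` IS ONTO EACH EIGEN-LATTICE

Cell `hodgecm-mathlib`, crux H413 (`stmt-HodgeConjecture-24833`, lane `--supports … --as helper`), route of record `HCCMUnconditional` (no route verbs;
count-neutral).  Programme R90-TF, section S4 = [Rogawski1990] Ch. 13.1–13.2 (twisted Weyl integration formula, §12.5 p. 186); seat R90-C131-p02 (g2);
ORDER = S4 dealer K2E2-plan (g8) S4-R59 (4) «(TJ6) HERBRAND WINDOW», spec S4-R63 (K2E3-p03 (g10)'s `h♮`).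

SETTING.  `K` a field with a valuation (`ValuativeRel`; a non-archimedean local field where topology is used), `α < 1` the level ratio, `𝔞 ⊆ M_m(K)`
a COMMUTATIVE `K`-subalgebra closed under inverses (at the datum: `𝔞 = Cent_{M₃(L_w)}(γ₀)`, `γ₀` regular), `E` an additive ANTI-involution of `M_m(K)`
(`E(XY) = E Y · E X`, `E 1 = 1`; at the datum `E X = Φ⁻¹ σ(X)ᵀ Φ`, the slot map of the twist `ε`), a parity `s` with `s·s = 1`, and the EIGEN-LATTICES
`M i = {X | X ≤ α^(i+1), X ∈ 𝔞, E X = s • X}` (a membership LETTER `hM`, no definition).  On the commutative `𝔞` the Cayley map `c(X) = (1 + X)(1 − X)⁻¹` turns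
the group law into `c(W)·c(Z) = c(S(W, Z))`, `S(W, Z) = (W + Z)(1 + WZ)⁻¹` («velocity addition»), so squaring is `c(W)² = c(2ψ(W))`, `ψ(W) = W(1 + W²)⁻¹`.

THE RESULTS (all PROVED).
* `valBound_psi_newton` — THE NEWTON REMAINDER: for commuting `x ≤ α^(k+1)`, `y ≤ α^(i+1)` (`k ≤ i`), `ψ(x + y) − ψ x − y ≤ α^(i+2)`
  (`= x³((1+x²)⁻¹ − (1+(x+y)²)⁻¹) − ((x+y)³ − x³)(1+(x+y)²)⁻¹`): `ψ` is the identity up to one level.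
* `eigen_antitone`, `isCompact_eigen`.
* **`exists_psi_eq`** — for every `a ∈ M i` there is `X ∈ M i` with `ψ(X) = a`: ★ (C1a) `image_coe_eq_of_newton` in the closed subgroup `N = 𝔞 ∩ {E X = s•X}`
  filtered by `N ∩ {X ≤ α^(j+1)} = M j` (open, compact, a basis of `0` by ★ (C4)).  Consequence (part 2c): `c(M i)² = c(2ψ(M i)) = c(2·M i)` EXACTLY.

HONEST LABEL: HC_CM is proved only modulo the 7 printed citations (2 remaining named inputs: hLiu418 = `stmt-HodgeConjecture-24832`, h413 =
`stmt-HodgeConjecture-24833`) until rung 0 closes; this file closes no socket (REL ≠ ★ ≠ BUILT; count-neutral).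

## References
* [Serre1992LALG] J.-P. Serre, *Lie Algebras and Lie Groups*, LNM 1500 (1992), Part II Ch. IV §8–§9 (standard groups, filtrations, the Cayley ∕ exponential charts). Context locator.
* [Serre1979] J.-P. Serre, *Local Fields*, GTM 67 (1979), VIII §4 (Herbrand quotient). Context locator.
* [PlatonovRapinchuk1994] V. Platonov, A. Rapinchuk, *Algebraic Groups and Number Theory* (1994), §3.3 (congruence subgroups, Cayley map). Context locator.
* [Rogawski1990] J. D. Rogawski, *Automorphic Representations of Unitary Groups in Three Variables*, Ann. of Math. Stud. 123 (1990), §12.5 p. 186. Context locator.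
-/

set_option autoImplicit false
-- the mandated namespace repeats the single-problem summit's segment (`HodgeConjecture.HodgeConjecture`)
set_option linter.dupNamespace false

open Set Filter TopologicalSpace Topology Matrix ValuativeRel
open Literature.NumberTheory.Automorphic Literature.NumberTheory.Weil1982.UnitaryFinTopForm
open Summit.HodgeConjecture.HodgeConjecture.Cruxes.H413.F0P3cStCharTSFilteredNewton
open Summit.HodgeConjecture.HodgeConjecture.Cruxes.H413.F0P3cStCharTSCayleyChartHaar
open scoped Pointwise Topology MatrixGroups

namespace Summit.HodgeConjecture.HodgeConjecture.R90.S4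

/-! ## §3 `ψ` is onto each eigen-lattice (filtered Newton, Cantor-intersection form) -/

section Newton

variable {K : Type*} [Field K] [ValuativeRel K] {m : Type*} [Fintype m] [DecidableEq m]

/-- **THE NEWTON REMAINDER OF `ψ`**: for commuting `x ≤ α^(k+1)`, `y ≤ α^(i+1)` (`k ≤ i`, `α < 1`),
`ψ(x + y) − ψ(x) − y = x³((1+x²)⁻¹ − (1+(x+y)²)⁻¹) − ((x+y)³ − x³)(1+(x+y)²)⁻¹ ≤ α^(i+2)` entrywise — `ψ` is the identity up to one level.
[cite: Serre1992LALG, Part II Ch. IV §9] -/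
theorem valBound_psi_newton {α : ValueGroupWithZero K} (hα1 : α < 1) {k i : ℕ} (hki : k ≤ i) {x y : Matrix m m K}
    (hx : ValBound (α ^ (k + 1)) x) (hy : ValBound (α ^ (i + 1)) y) (hc : x * y = y * x) :
    ValBound (α ^ (i + 2)) ((x + y) * (1 + (x + y) * (x + y))⁻¹ - x * (1 + x * x)⁻¹ - y) := by
  have hαk : α ^ (k + 1) < 1 := pow_lt_one₀ zero_le hα1 (Nat.succ_ne_zero k)
  have hik : α ^ (i + 1) ≤ α ^ (k + 1) := pow_le_pow_right_of_le_one' hα1.le (by omega)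
  have hxy : ValBound (α ^ (k + 1)) (x + y) := hx.add (hy.mono hik)
  obtain ⟨hA, hAi1, -⟩ := isUnit_det_one_add_mul_of_valBound hx hx hαk hαk.le
  obtain ⟨hB, hBi1, -⟩ := isUnit_det_one_add_mul_of_valBound hxy hxy hαk hαk.le
  set A : Matrix m m K := 1 + x * x with hAdef
  set B : Matrix m m K := 1 + (x + y) * (x + y) with hBdef
  -- `w (1 + w²)⁻¹ = w − w³ (1 + w²)⁻¹`
  have eA : x * A⁻¹ = x - x * x * x * A⁻¹ := by
    have hxA : x + x * x * x = x * A := by rw [hAdef]; noncomm_ring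
    rw [eq_sub_iff_add_eq, ← add_mul, hxA, Matrix.mul_nonsing_inv_cancel_right _ _ hA]
  have eB : (x + y) * B⁻¹ = (x + y) - (x + y) * (x + y) * (x + y) * B⁻¹ := by
    have hxB : (x + y) + (x + y) * (x + y) * (x + y) = (x + y) * B := by rw [hBdef]; noncomm_ring
    rw [eq_sub_iff_add_eq, ← add_mul, hxB, Matrix.mul_nonsing_inv_cancel_right _ _ hB]
  -- `A⁻¹ − B⁻¹ = A⁻¹ (B − A) B⁻¹`, `B − A = y (x + (x + y))`, `(x+y)³ − x³ = y Q`
  have eAB : A⁻¹ - B⁻¹ = A⁻¹ * (B - A) * B⁻¹ := by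
    rw [Matrix.mul_sub, Matrix.sub_mul, Matrix.mul_nonsing_inv_cancel_right _ _ hB, Matrix.nonsing_inv_mul _ hA, Matrix.one_mul]
  have eBA : B - A = y * (x + (x + y)) := by
    rw [hBdef, hAdef]
    have h : (1 + (x + y) * (x + y)) - (1 + x * x) - y * (x + (x + y)) = x * y - y * x := by noncomm_ring
    rw [hc, sub_self] at h
    exact sub_eq_zero.1 h
  have eQ : (x + y) * (x + y) * (x + y) - x * x * x = y * ((x + y) * (x + y) + (x + y) * x + x * x) := by
    have h : (x + y) * (x + y) * (x + y) - x * x * x - y * ((x + y) * (x + y) + (x + y) * x + x * x) =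
        x * x * y + x * y * x + x * y * y - y * x * x - y * x * x - y * y * x := by noncomm_ring
    have h1 : x * x * y = y * x * x := by rw [mul_assoc, hc, ← mul_assoc, hc]
    have h2 : x * y * x = y * x * x := by rw [hc]
    have h3 : x * y * y = y * y * x := by rw [hc, mul_assoc, hc, ← mul_assoc]
    rw [h1, h2, h3] at h
    have h0 : y * x * x + y * x * x + y * y * x - y * x * x - y * x * x - y * y * x = 0 := by abel
    rw [h0] at h
    exact sub_eq_zero.1 h
  -- the remainder in closed form
  have eR : (x + y) * B⁻¹ - x * A⁻¹ - y = x * x * x * (A⁻¹ * (B - A) * B⁻¹) - y * ((x + y) * (x + y) + (x + y) * x + x * x) * B⁻¹ := by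
    rw [← eAB, ← eQ, eA, eB]
    noncomm_ring
  rw [eR]
  -- bounds
  have h1 : ValBound 1 x := hx.mono hαk.le
  have hxy1 : ValBound 1 (x + y) := hxy.mono hαk.le
  have hsum : ValBound (α ^ (k + 1)) (x + (x + y)) := hx.add hxy
  have hBA : ValBound (α ^ (i + 1) * α ^ (k + 1)) (B - A) := by rw [eBA]; exact hy.mul hsum
  have hT1 : ValBound (α ^ (i + 1) * α ^ (k + 1)) (x * x * x * (A⁻¹ * (B - A) * B⁻¹)) := by
    have h := ((h1.mul h1).mul h1).mul ((hAi1.mul hBA).mul hBi1)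
    simpa using h
  have hQ : ValBound (α ^ (k + 1) * 1) ((x + y) * (x + y) + (x + y) * x + x * x) :=
    ((hxy.mul hxy1).add (hxy.mul h1)).add (hx.mul h1)
  have hT2 : ValBound (α ^ (i + 1) * α ^ (k + 1)) (y * ((x + y) * (x + y) + (x + y) * x + x * x) * B⁻¹) := by
    have h := (hy.mul hQ).mul hBi1
    simpa using h
  have hle : α ^ (i + 1) * α ^ (k + 1) ≤ α ^ (i + 2) := by
    rw [pow_succ α (i + 1)]
    exact mul_le_mul' le_rfl (by simpa using pow_le_pow_right_of_le_one' hα1.le (show 1 ≤ k + 1 by omega))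
  exact (hT1.sub hT2).mono hle

variable [TopologicalSpace K] [IsNonarchimedeanLocalField K]
  (𝔞 : Subalgebra K (Matrix m m K)) (h𝔞c : ∀ X ∈ 𝔞, ∀ Y ∈ 𝔞, X * Y = Y * X) (h𝔞i : ∀ X ∈ 𝔞, IsUnit X.det → X⁻¹ ∈ 𝔞)
  (h𝔞cl : IsClosed (𝔞 : Set (Matrix m m K)))
  (E : Matrix m m K →+ Matrix m m K) (hEm : ∀ X Y, E (X * Y) = E Y * E X) (hE1 : E 1 = 1) (hEc : Continuous E)
  {s : K} (hs : s * s = 1) {α : ValueGroupWithZero K} (hα : α ≠ 0) (hα1 : α < 1)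
  (M : ℕ → AddSubgroup (Matrix m m K)) (hM : ∀ i X, X ∈ M i ↔ (ValBound (α ^ (i + 1)) X ∧ X ∈ 𝔞 ∧ E X = s • X))

omit [TopologicalSpace K] [IsNonarchimedeanLocalField K] in
include hM hα1 in
/-- Deeper eigen-lattices are smaller. [cite: Serre1992LALG, Part II Ch. IV §9] -/
theorem eigen_antitone : Antitone M := by
  intro i j hij X hX
  obtain ⟨hb, h𝔞', hE'⟩ := (hM j X).1 hX
  exact (hM i X).2 ⟨hb.mono (pow_le_pow_right_of_le_one' hα1.le (by omega)), h𝔞', hE'⟩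

include h𝔞cl hEc hM in
/-- Each eigen-lattice is compact (a closed subset of a compact ball). [cite: Serre1992LALG, Part II Ch. IV §9] -/
theorem isCompact_eigen (i : ℕ) : IsCompact (M i : Set (Matrix m m K)) := by
  haveI : T2Space K := (Literature.NumberTheory.GaloisRepresentations.IsNonarchimedeanLocalField.isLocalField K).toT2Space
  have hset : (M i : Set (Matrix m m K)) = {X | ValBound (α ^ (i + 1)) X} ∩ ((𝔞 : Set (Matrix m m K)) ∩ {X | E X = s • X}) := by
    ext X
    simp only [Set.mem_inter_iff, Set.mem_setOf_eq, SetLike.mem_coe]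
    exact hM i X
  rw [hset]
  exact (isCompact_setOf_valBound_matrix _).inter_right (h𝔞cl.inter (isClosed_eq hEc (continuous_const_smul s)))

include h𝔞c h𝔞i h𝔞cl hEm hE1 hEc hs hα hα1 hM in
/-- **`ψ` IS ONTO EACH EIGEN-LATTICE**: for every `a ∈ M i` there is `X ∈ M i` with `X(1 + X²)⁻¹ = a` — ★ (C1a) `image_coe_eq_of_newton` applied in the closed
subgroup `N = 𝔞 ∩ {E X = s•X}` with the level filtration `N ∩ {X ≤ α^(j+1)} = M j` (open, compact, a basis of `0`), to `ψ`, which is the identity up to one level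
(`valBound_psi_newton`). [cite: Serre1992LALG, Part II Ch. IV §9] -/
theorem exists_psi_eq (i : ℕ) {a : Matrix m m K} (ha : a ∈ M i) : ∃ X ∈ M i, X * (1 + X * X)⁻¹ = a := by
  classical
  haveI : T2Space K := (Literature.NumberTheory.GaloisRepresentations.IsNonarchimedeanLocalField.isLocalField K).toT2Space
  -- the closed subgroup `N`
  let N : AddSubgroup (Matrix m m K) :=
    { carrier := {X | X ∈ 𝔞 ∧ E X = s • X}
      add_mem' := fun {a b} ha hb => ⟨𝔞.add_mem ha.1 hb.1, by rw [map_add, ha.2, hb.2, smul_add]⟩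
      zero_mem' := ⟨𝔞.zero_mem, by rw [map_zero, smul_zero]⟩
      neg_mem' := fun {a} ha => ⟨𝔞.neg_mem ha.1, by rw [map_neg, ha.2, smul_neg]⟩ }
  have hNcl : IsClosed (N : Set (Matrix m m K)) := by
    show IsClosed {X | X ∈ 𝔞 ∧ E X = s • X}
    exact h𝔞cl.inter (isClosed_eq hEc (continuous_const_smul s))
  let ι' : ↥N →+ Matrix m m K := N.subtype
  have hι' : IsClosedEmbedding ι' := hNcl.isClosedEmbedding_subtypeVal
  let Λ' : ℕ → AddSubgroup ↥N := fun j => (M j).comap ι'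
  have hΛ' : ∀ j (X : ↥N), X ∈ Λ' j ↔ ValBound (α ^ (j + 1)) (ι' X) := by
    intro j X
    show (X : Matrix m m K) ∈ M j ↔ _
    rw [hM]
    exact ⟨fun h => h.1, fun h => ⟨h, X.2.1, X.2.2⟩⟩
  have hanti : Antitone Λ' := level_antitone ι' Λ' hΛ' hα1.le
  have hopen : ∀ j, IsOpen (Λ' j : Set ↥N) := isOpen_level ι' Λ' hι'.continuous hΛ' hα
  have hcomp : ∀ j, IsCompact (Λ' j : Set ↥N) := isCompact_level ι' Λ' hι' hΛ'
  have hbasis := exists_level_subset_of_mem_nhds ι' Λ' hι' hΛ' hα1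
  -- the map `ψ` on `N`
  have hmemψ : ∀ X : ↥N, ValBound α (X : Matrix m m K) → (X : Matrix m m K) * (1 + (X : Matrix m m K) * X)⁻¹ ∈ N := by
    intro X hXb
    obtain ⟨hB, -, -⟩ := isUnit_det_one_add_mul_of_valBound hXb hXb hα1 hα1.le
    have hB𝔞 : 1 + (X : Matrix m m K) * X ∈ 𝔞 := 𝔞.add_mem 𝔞.one_mem (𝔞.mul_mem X.2.1 X.2.1)
    refine ⟨𝔞.mul_mem X.2.1 (h𝔞i _ hB𝔞 hB), ?_⟩
    rw [hEm, map_nonsing_inv_eq E hEm hE1 hB, map_one_add_mul_eq E hEm hE1 hs X.2.2 X.2.2 rfl, X.2.2, mul_smul_comm,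
      nonsing_inv_comm_of_comm hB (by rw [add_mul, mul_add, one_mul, mul_one, mul_assoc])]
  let ψ' : ↥N → ↥N := fun X => if h : ValBound α (X : Matrix m m K) then ⟨_, hmemψ X h⟩ else 0
  have hψ'val : ∀ X : ↥N, ValBound α (X : Matrix m m K) →
      ((ψ' X : ↥N) : Matrix m m K) = (X : Matrix m m K) * (1 + (X : Matrix m m K) * X)⁻¹ := by
    intro X h
    simp only [ψ', dif_pos h]
  have hlev : ∀ {j} {X : ↥N}, X ∈ Λ' j → ValBound α (X : Matrix m m K) := by
    intro j X hX
    exact ((hΛ' j X).1 hX).mono (by simpa using pow_le_pow_right_of_le_one' hα1.le (show 1 ≤ j + 1 by omega))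
  -- the Newton hypothesis at depth `i`
  have hN : ∀ j, i ≤ j → ∀ x ∈ Λ' i, ∀ y ∈ Λ' j, ψ' (x + y) - ψ' x - y ∈ Λ' (j + 1) := by
    intro j hij x hx y hy
    have hxy : x + y ∈ Λ' i := (Λ' i).add_mem hx (hanti hij hy)
    rw [hΛ']
    have hv : ι' (ψ' (x + y) - ψ' x - y) = ((x : Matrix m m K) + y) * (1 + ((x : Matrix m m K) + y) * ((x : Matrix m m K) + y))⁻¹ -
        (x : Matrix m m K) * (1 + (x : Matrix m m K) * x)⁻¹ - y := by
      show ((ψ' (x + y) - ψ' x - y : ↥N) : Matrix m m K) = _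
      rw [AddSubgroup.coe_sub, AddSubgroup.coe_sub, hψ'val _ (hlev hxy), hψ'val _ (hlev hx), AddSubgroup.coe_add]
    rw [hv, show j + 1 + 1 = j + 2 by omega]
    exact valBound_psi_newton hα1 hij ((hΛ' i x).1 hx) ((hΛ' j y).1 hy) (h𝔞c _ x.2.1 _ y.2.1)
  -- continuity on the base box
  have hψc : ContinuousOn ψ' (Λ' i : Set ↥N) := by
    rw [IsInducing.subtypeVal.continuousOn_iff]
    have hform : ContinuousOn (fun X : ↥N => (X : Matrix m m K) * (1 + (X : Matrix m m K) * X)⁻¹) (Λ' i : Set ↥N) := by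
      intro X hX
      obtain ⟨hB, -, -⟩ := isUnit_det_one_add_mul_of_valBound (hlev hX) (hlev hX) hα1 hα1.le
      have hinv : ContinuousAt Inv.inv (1 + (X : Matrix m m K) * X) := by
        refine continuousAt_matrix_inv _ ?_
        rw [Ring.inverse_eq_inv']
        exact continuousAt_inv₀ hB.ne_zero
      have hq : Continuous fun X : ↥N => 1 + (X : Matrix m m K) * X :=
        continuous_const.add (continuous_subtype_val.mul continuous_subtype_val)
      exact (continuous_subtype_val.continuousAt.mul (ContinuousAt.comp (g := Inv.inv) hinv hq.continuousAt)).continuousWithinAt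
    refine hform.congr fun X hX => ?_
    simp only [Function.comp_apply, hψ'val X (hlev hX)]
  have h0 : ψ' 0 ∈ Λ' i := by
    have h00 : ψ' 0 = 0 := by
      apply Subtype.ext
      rw [hψ'val 0 (by simpa using valBound_zero α)]
      simp
    rw [h00]
    exact zero_mem _
  have himg := image_coe_eq_of_newton Λ' ψ' hanti hopen (hcomp i) hbasis hψc hN h0
  -- read off
  obtain ⟨-, ha𝔞, hEa⟩ := (hM i a).1 ha
  have haΛ : (⟨a, ha𝔞, hEa⟩ : ↥N) ∈ (Λ' i : Set ↥N) := by show a ∈ M i; exact ha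
  rw [← himg] at haΛ
  obtain ⟨X, hX, hXa⟩ := haΛ
  refine ⟨X, hX, ?_⟩
  have h := congrArg (fun Z : ↥N => (Z : Matrix m m K)) hXa
  simpa only [hψ'val X (hlev hX)] using h

end Newton

end Summit.HodgeConjecture.HodgeConjecture.R90.S4
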